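import Summits.ResolutionOfSingularities.ResolutionOfSingularities.Theorems.WeightedInvariantContactCylinderDescentLemmas
import Literature.RingTheory.RegularLocalRing.QuotientDVR
import HarnessLib

/-!
# MAXIMISER DESCENT at a special point of a permissible equimultiple curve — the pair in `S_P` and one steepening step
# (ORDER (o28), regime P3a, obligation (P3a-desc) of res-L1-w43-plan-1's IOTA3-DESIGN v1 §3)
# (door `HypersurfaceCentreConstruction`, stmt-ResolutionOfSingularities-19897; KEY `stub_localWeightedDropEFT4S`)

Topic: `Summits/ResolutionOfSingularities/ResolutionOfSingularities/Theorems`. Helper for the door item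
`HypersurfaceCentreConstruction` (stmt-ResolutionOfSingularities-19897, route `WeightedInvariant`), line `local-engine` of
res-L1-w43-plan-1 (L W4.3), ORDER (o28) (lead res-type-005, co-hand res-D-brk-1).  Second of three files of the maximiser
descent (`…DescentLemmas` ← this ← `…Descent`): the facts about a pair `(x, g) ⊆ S` with independent differentials generating
the prime `P`, read in `R = S_P` (`pair_facts`: `(x/1, g/1) = 𝔪_R`, neither in `𝔪_R²`, `g/1 ∉ (x/1)`); the VALUATION DICHOTOMY
of `S ⧸ P` read in `R` (`exists_or_of_dichotomy`) and its source, `S ⧸ P` a discrete valuation ring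
(`dichotomy_of_ringKrullDim_quotient_eq_one`, Matsumura 11.2 via Literature `QuotientDVR`); regularity of `S ⧸ (x, g)`;
swapping the pair; and THE STEP (`step`): if `g₁/1 + μ (x₁/1)^c` carries `f/1` to level `c + 1` and `μ ≡ a/1 (mod 𝔪_R)` with
`a ∈ S`, then the `S`-pair `(x₁, g₁ + a x₁^c)` does too.

[OURS · L1 W4.3 · (o28) P3a]  Replaces the role of NO printed item; NOT a statement of the manuscript
[claim: Hironaka2017, status: under-review]. AI work, weaker than expert review.  Pure commutative algebra; no named facts.

## References

* H. Matsumura, *Commutative Ring Theory* (1987), Thm. 11.2, 14.2, 14.3. [Matsumura1987]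
* res-L1-w43-plan-1, `L/res-L1-w43-plan-1/IOTA3-DESIGN.md` v1 §3 P3a (OURS, AI planning).
-/

noncomputable section

open IsLocalRing Literature.AlgebraicGeometry.Resolution
open Summit.ResolutionOfSingularities.ResolutionOfSingularities.Cruxes.HypersurfaceCentreConstruction.LocalEngine

set_option linter.dupNamespace false -- mandated namespace of this single-conjunct summit

namespace Summit.ResolutionOfSingularities.ResolutionOfSingularities.Theorems

namespace ContactCylinder

namespace Descent

section Main

variable {S : Type} [CommRing S] [IsRegularLocalRing S] (P : Ideal S) [P.IsPrime]

/-! ## The pair `(x, g)` read in `R = S_P` -/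

/-- For a pair `x, g ∈ 𝔪_S` with independent differentials generating the prime `P`: in `R = S_P`, `(x/1, g/1) = 𝔪_R`,
neither image lies in `𝔪_R²`, `g/1 ∉ (x/1)`, and `(x) R ∩ S = (x)`. [cite: Matsumura1987, Thm. 14.2] -/
theorem pair_facts {x g : S} (hxg : ∀ i, (![x, g] : Fin 2 → S) i ∈ maximalIdeal S)
    (hli : LinearIndependent (ResidueField S) (fun i => (maximalIdeal S).toCotangent ⟨(![x, g] : Fin 2 → S) i, hxg i⟩))
    (hP : Ideal.span {x, g} = P) :
    Ideal.span {algebraMap S (Localization.AtPrime P) x, algebraMap S (Localization.AtPrime P) g} =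
        maximalIdeal (Localization.AtPrime P) ∧
      algebraMap S (Localization.AtPrime P) g ∉ maximalIdeal (Localization.AtPrime P) ^ 2 ∧
      algebraMap S (Localization.AtPrime P) x ∉ maximalIdeal (Localization.AtPrime P) ^ 2 ∧
      algebraMap S (Localization.AtPrime P) g ∉ Ideal.span {algebraMap S (Localization.AtPrime P) x} := by
  haveI : IsRegularLocalRing (Localization.AtPrime P) := isRegularLocalRing_localization_atPrime S P
  have hx𝔭 : ∀ i, (![x, g] : Fin 2 → S) i ∈ P := fun i => hP ▸ Ideal.subset_span (by fin_cases i <;> simp)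
  have hmax : Ideal.span {algebraMap S (Localization.AtPrime P) x, algebraMap S (Localization.AtPrime P) g} =
      maximalIdeal (Localization.AtPrime P) := by
    rw [← Localization.AtPrime.map_eq_maximalIdeal,
      show Ideal.map (algebraMap S (Localization.AtPrime P)) P =
        Ideal.map (algebraMap S (Localization.AtPrime P)) (Ideal.span {x, g}) by rw [hP], Ideal.map_span, Set.image_pair]
  have hvec : (fun i => algebraMap S (Localization.AtPrime P) ((![x, g] : Fin 2 → S) i)) =
      ![algebraMap S (Localization.AtPrime P) x, algebraMap S (Localization.AtPrime P) g] := by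
    funext i; fin_cases i <;> rfl
  -- `𝔪_R² ∩ S = (x, g)² ⊆ 𝔪_S²`
  have hQ : maximalIdeal (Localization.AtPrime P) ^ 2 =
      (weightedMonomialIdeal ![x, g] ![1, 1] 2).map (algebraMap S (Localization.AtPrime P)) := by
    rw [← hmax, ← LocalGameEFTSteepening.weightedMonomialIdeal_one_eq_pow, weightedMonomialIdeal_map, hvec]
  have hP𝔪 : Ideal.span {x, g} ≤ maximalIdeal S := by
    rw [Ideal.span_le, Set.insert_subset_iff, Set.singleton_subset_iff]
    exact ⟨hxg 0, hxg 1⟩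
  have hsq : ∀ i, algebraMap S (Localization.AtPrime P) ((![x, g] : Fin 2 → S) i) ∉
      maximalIdeal (Localization.AtPrime P) ^ 2 := by
    intro i h
    rw [hQ, ← Ideal.mem_comap,
      comap_map_weightedMonomialIdeal_eq_of_linearIndependent P ![x, g] hxg hli hx𝔭 ![1, 1]
        (Fin.forall_fin_two.2 ⟨Nat.one_pos, Nat.one_pos⟩) one_le_two,
      LocalGameEFTSteepening.weightedMonomialIdeal_one_eq_pow] at h
    exact hli.ne_zero i ((Ideal.toCotangent_eq_zero _ _).mpr (Ideal.pow_right_mono hP𝔪 2 h))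
  refine ⟨hmax, hsq 1, hsq 0, fun h => ?_⟩
  -- `g/1 ∈ (x/1)` would give `g ∈ (x) R ∩ S = (x)`
  have hxprime : (Ideal.span {x}).IsPrime := by
    have h := isPrime_span_image_of_linearIndependent_toCotangent (![x, g]) hxg hli {0}
    rwa [Set.image_singleton] at h
  have hdisj : Disjoint (P.primeCompl : Set S) (Ideal.span {x} : Set S) :=
    Set.disjoint_left.mpr fun a ha hax => ha ((Ideal.span_singleton_le_iff_mem P).mpr (hx𝔭 0) hax)
  have hg : algebraMap S (Localization.AtPrime P) g ∈ (Ideal.span {x}).map (algebraMap S (Localization.AtPrime P)) := by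
    rw [Ideal.map_span, Set.image_singleton]
    exact h
  rw [← Ideal.mem_comap] at hg
  have hcomap : ((Ideal.span {x}).map (algebraMap S (Localization.AtPrime P))).comap
      (algebraMap S (Localization.AtPrime P)) = Ideal.span {x} :=
    IsLocalization.under_map_of_isPrime_disjoint P.primeCompl (Localization.AtPrime P) hxprime hdisj
  rw [hcomap] at hg
  have hng := not_mem_span_image_of_linearIndependent_toCotangent (![x, g]) hxg hli 1 {0} (by simp)
  rw [Set.image_singleton] at hng
  exact hng hg

omit [IsRegularLocalRing S] in
/-- **The valuation dichotomy of `S ⧸ P`, read in `R = S_P`**: every `μ ∈ R` is congruent to some `a/1` (`a ∈ S`) modulo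
`𝔪_R`, or else `μ · c/1 ≡ 1 (mod 𝔪_R)` for some `c ∈ 𝔪_S`. [folklore] -/
theorem exists_or_of_dichotomy [IsLocalRing S]
    (hval : ∀ a b : S, b ∉ P → ∃ c : S, a - b * c ∈ P ∨ (c ∈ maximalIdeal S ∧ b - a * c ∈ P))
    (μ : Localization.AtPrime P) :
    (∃ a : S, μ - algebraMap S (Localization.AtPrime P) a ∈ maximalIdeal (Localization.AtPrime P)) ∨
      ∃ c : S, c ∈ maximalIdeal S ∧ μ * algebraMap S (Localization.AtPrime P) c - 1 ∈ maximalIdeal (Localization.AtPrime P) := by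
  obtain ⟨⟨m, s⟩, hms⟩ := IsLocalization.surj P.primeCompl μ
  have hs : (s : S) ∉ P := s.2
  have hmaxP : ∀ a : S, algebraMap S (Localization.AtPrime P) a ∈ maximalIdeal (Localization.AtPrime P) ↔ a ∈ P :=
    fun a => IsLocalization.AtPrime.to_map_mem_maximal_iff (Localization.AtPrime P) P a
  have hs' : algebraMap S (Localization.AtPrime P) (s : S) ∉ maximalIdeal (Localization.AtPrime P) :=
    fun h => hs ((hmaxP s).mp h)
  obtain ⟨c, hc | ⟨hc𝔪, hc⟩⟩ := hval m s hs
  · refine Or.inl ⟨c, ?_⟩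
    have h1 : (μ - algebraMap S _ c) * algebraMap S (Localization.AtPrime P) (s : S) =
        algebraMap S (Localization.AtPrime P) (m - s * c) := by
      rw [sub_mul, hms, map_sub, map_mul]
      ring
    have h2 : (μ - algebraMap S _ c) * algebraMap S (Localization.AtPrime P) (s : S) ∈
        maximalIdeal (Localization.AtPrime P) := by
      rw [h1]
      exact (hmaxP _).mpr hc
    exact ((Ideal.IsPrime.mul_mem_iff_mem_or_mem inferInstance).mp h2).resolve_right hs'
  · refine Or.inr ⟨c, hc𝔪, ?_⟩
    have h1 : (μ * algebraMap S _ c - 1) * algebraMap S (Localization.AtPrime P) (s : S) =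
        -algebraMap S (Localization.AtPrime P) (s - m * c) := by
      rw [sub_mul, mul_assoc, mul_comm (algebraMap S _ c), ← mul_assoc, hms, map_sub, map_mul]
      ring
    have h2 : (μ * algebraMap S _ c - 1) * algebraMap S (Localization.AtPrime P) (s : S) ∈
        maximalIdeal (Localization.AtPrime P) := by
      rw [h1]
      exact neg_mem ((hmaxP _).mpr hc)
    exact ((Ideal.IsPrime.mul_mem_iff_mem_or_mem inferInstance).mp h2).resolve_right hs'

/-- **The valuation dichotomy of a discrete valuation ring `S ⧸ P`** (the P3a curve: `S ⧸ P` regular of Krull dimension one;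
Matsumura 11.2): for `a, b ∈ S`, modulo `P` either `b ∣ a`, or `a ∣ b` with a NON-UNIT cofactor.
[cite: Matsumura1987, Thm. 11.2] -/
theorem dichotomy_of_ringKrullDim_quotient_eq_one (hreg : IsRegularLocalRing (S ⧸ P)) (hdim : ringKrullDim (S ⧸ P) = 1)
    (a b : S) : ∃ c : S, a - b * c ∈ P ∨ (c ∈ maximalIdeal S ∧ b - a * c ∈ P) := by
  haveI := hreg
  haveI : IsDiscreteValuationRing (S ⧸ P) :=
    Literature.RingTheory.RegularLocalRing.isDiscreteValuationRing_of_ringKrullDim_eq_one hdim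
  obtain ⟨c, hc | hc⟩ := ValuationRing.cond (Ideal.Quotient.mk P b) (Ideal.Quotient.mk P a)
  · -- `b̄ c̄ = ā`
    obtain ⟨c, rfl⟩ := Ideal.Quotient.mk_surjective c
    refine ⟨c, Or.inl ?_⟩
    rw [← Ideal.Quotient.eq, map_mul]
    exact hc.symm
  · -- `ā c̄ = b̄`
    obtain ⟨c, rfl⟩ := Ideal.Quotient.mk_surjective c
    by_cases hcu : c ∈ maximalIdeal S
    · refine ⟨c, Or.inr ⟨hcu, ?_⟩⟩
      rw [← Ideal.Quotient.eq, map_mul]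
      exact hc.symm
    · -- `c` is a unit of `S`: `b̄ c̄⁻¹ = ā`
      have hcu' : IsUnit c := not_not.mp (mt (IsLocalRing.mem_maximalIdeal c).mpr hcu)
      obtain ⟨u, rfl⟩ := hcu'
      refine ⟨(↑u⁻¹ : S), Or.inl ?_⟩
      rw [← Ideal.Quotient.eq, map_mul, ← hc, mul_assoc, ← map_mul, Units.mul_inv, map_one, mul_one]

/-! ## One steepening step with an integral coefficient -/

/-- **The step**: if `γ' = g₁/1 + μ (x₁/1)^c` carries `f/1` to level `c + 1` and `μ ≡ a/1 (mod 𝔪_R)` with `a ∈ S`, then the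
pair `(x₁, g₁ + a x₁^c) ⊆ S` — same span, still independent differentials — carries `f/1` to level `c + 1` as well.
[OURS · L1 W4.3 · (o28) P3a] -/
theorem step {x₁ g₁ : S} (hxg : ∀ i, (![x₁, g₁] : Fin 2 → S) i ∈ maximalIdeal S)
    (hli : LinearIndependent (ResidueField S) (fun i => (maximalIdeal S).toCotangent ⟨(![x₁, g₁] : Fin 2 → S) i, hxg i⟩))
    (hP : Ideal.span {x₁, g₁} = P) {c : ℕ} (hc : 1 ≤ c) (μ : Localization.AtPrime P) (a : S)
    (hμa : μ - algebraMap S (Localization.AtPrime P) a ∈ maximalIdeal (Localization.AtPrime P)) {F : Localization.AtPrime P}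
    {N : ℕ} (hF : F ∈ contactFiltration (algebraMap S (Localization.AtPrime P) g₁ +
      μ * algebraMap S (Localization.AtPrime P) x₁ ^ c) (c + 1) N) :
    Ideal.span {x₁, g₁ + a * x₁ ^ c} = P ∧
    ∃ hxg' : ∀ i, (![x₁, g₁ + a * x₁ ^ c] : Fin 2 → S) i ∈ maximalIdeal S,
      LinearIndependent (ResidueField S) (fun i => (maximalIdeal S).toCotangent
        ⟨(![x₁, g₁ + a * x₁ ^ c] : Fin 2 → S) i, hxg' i⟩) ∧
      F ∈ contactFiltration (algebraMap S (Localization.AtPrime P) (g₁ + a * x₁ ^ c)) (c + 1) N := by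
  obtain ⟨hmax, -, -, -⟩ := pair_facts P hxg hli hP
  have hxg' : ∀ i, (![x₁, g₁ + a * x₁ ^ c] : Fin 2 → S) i ∈ maximalIdeal S := by
    refine Fin.forall_fin_two.2 ⟨hxg 0, Ideal.add_mem _ (hxg 1) (Ideal.mul_mem_left _ _ (Ideal.pow_mem_of_mem _ (hxg 0) _ hc))⟩
  refine ⟨by rw [span_pair_add_mul_pow_eq x₁ g₁ a hc, hP], hxg',
    linearIndependent_toCotangent_pair_add_mul_pow a hc hxg hli hxg', ?_⟩
  -- both parameters span `𝔪_R` together with `x₁/1`, and their `(1, c+1)`-filtrations agree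
  have hspan_a : Ideal.span {algebraMap S (Localization.AtPrime P) x₁, algebraMap S (Localization.AtPrime P) g₁ +
      algebraMap S (Localization.AtPrime P) a * algebraMap S (Localization.AtPrime P) x₁ ^ c} =
      maximalIdeal (Localization.AtPrime P) := by
    rw [span_pair_add_mul_pow_eq _ _ _ hc, hmax]
  have hspan_μ : Ideal.span {algebraMap S (Localization.AtPrime P) x₁, algebraMap S (Localization.AtPrime P) g₁ +
      μ * algebraMap S (Localization.AtPrime P) x₁ ^ c} = maximalIdeal (Localization.AtPrime P) := by
    rw [span_pair_add_mul_pow_eq _ _ _ hc, hmax]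
  have hμa' : μ - algebraMap S (Localization.AtPrime P) a ∈
      Ideal.span {algebraMap S (Localization.AtPrime P) x₁, algebraMap S (Localization.AtPrime P) g₁} := by
    rw [hmax]; exact hμa
  rw [map_add, map_mul, map_pow, contactFiltration_def,
    ← ContactFiltration.weightedMonomialIdeal_eq_contactFiltration hspan_a (by omega : 1 ≤ c + 1),
    weightedMonomialIdeal_pair_add_mul_pow_eq _ _ μ _ hc hμa',
    ContactFiltration.weightedMonomialIdeal_eq_contactFiltration hspan_μ (by omega : 1 ≤ c + 1), ← contactFiltration_def]
  exact hF

/-- Swapping the pair keeps membership and independence. [folklore] -/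
theorem pair_swap {x g : S} (hxg : ∀ i, (![x, g] : Fin 2 → S) i ∈ maximalIdeal S)
    (hli : LinearIndependent (ResidueField S) (fun i => (maximalIdeal S).toCotangent ⟨(![x, g] : Fin 2 → S) i, hxg i⟩)) :
    ∃ hgx : ∀ i, (![g, x] : Fin 2 → S) i ∈ maximalIdeal S,
      LinearIndependent (ResidueField S) (fun i => (maximalIdeal S).toCotangent ⟨(![g, x] : Fin 2 → S) i, hgx i⟩) := by
  have hgx : ∀ i, (![g, x] : Fin 2 → S) i ∈ maximalIdeal S := Fin.forall_fin_two.2 ⟨hxg 1, hxg 0⟩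
  refine ⟨hgx, ?_⟩
  have h := hli.comp (Equiv.swap (0 : Fin 2) 1) (Equiv.injective _)
  have hfun : (fun i => (maximalIdeal S).toCotangent ⟨(![x, g] : Fin 2 → S) i, hxg i⟩) ∘ (Equiv.swap (0 : Fin 2) 1) =
      (fun i => (maximalIdeal S).toCotangent ⟨(![g, x] : Fin 2 → S) i, hgx i⟩) := by
    funext i; fin_cases i <;> rfl
  rw [hfun] at h
  exact h

omit [P.IsPrime] in
/-- `S ⧸ (x, g₀)` is a regular local ring for a pair with independent differentials (Matsumura 14.2, tree
`isRegularLocalRing_quotient_span_range`). [cite: Matsumura1987, Thm. 14.2] -/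
theorem isRegularLocalRing_quotient_of_pair {x g₀ : S} (hxg : ∀ i, (![x, g₀] : Fin 2 → S) i ∈ maximalIdeal S)
    (hli : LinearIndependent (ResidueField S) (fun i => (maximalIdeal S).toCotangent ⟨(![x, g₀] : Fin 2 → S) i, hxg i⟩))
    (hP : Ideal.span {x, g₀} = P) : IsRegularLocalRing (S ⧸ P) := by
  haveI := isRegularLocalRing_quotient_span_range (![x, g₀]) hxg hli
  have hrange : Ideal.span (Set.range (![x, g₀] : Fin 2 → S)) = P := by rw [Matrix.range_cons_cons_empty, hP]
  exact IsRegularLocalRing.of_ringEquiv (Ideal.quotEquivOfEq hrange)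

end Main

end Descent

end ContactCylinder

end Summit.ResolutionOfSingularities.ResolutionOfSingularities.Theorems

end
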